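import Literature.NumberTheory.EllipticCurves.PAdicOneVariableNormCoherentUnitInduceMomentsOfCharacter
import Literature.NumberTheory.EllipticCurves.PAdicOneVariableEquivarianceOfComparison
import HarnessLib

/-!
# `p = 2`, ABSTRACT TOWER, ABSTRACT SERIES: de Shalit's `i = induce D` for a `G`-monoid `B` carrying a family of
# `𝐃`-series `b ↦ φ_b ∈ 𝒪̂_{F^nr}⟦X⟧` that is ADDITIVE and `[κ]`-EQUIVARIANT on `U_0` — additivity, `hD`, and the
# homomorphism properties of `i` (the β-agnostic core of I.3.4 / II.4.6, serving absolute AND relative units)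

Topic `NumberTheory/EllipticCurves`; namespace `Literature.NumberTheory.EllipticCurves`.

De Shalit, *Iwasawa theory of elliptic curves with complex multiplication* (1987), I.3.3–3.4 and II.4.6: the
measure of a unit `β` depends on `β` only through the series `φ_β = (δβ)~` over `𝒪̂_{F^nr}` (read through the
comparison `ϑ : 𝔾̂_m ≅ F_{f'}` and a coefficient map `Θ : 𝐃 → 𝕜`: `D_β = comap ((x⁻¹ D_{Θ(φ_β ∘ ϑ)})|_{ℤ₂ˣ}) ψ`),
and the two properties of `β ↦ φ_β` that drive Lemma 3.4 are (i) `φ_{ββ'} = φ_β + φ_{β'}` and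
(ii) `φ_{σβ} = κ(σ) · (φ_β ∘ [κ(σ)]_{f'})`.  The sibling files proved everything for the ABSOLUTE norm-coherent units
(`φ_β = ((δβ)~).map ι`, `…NormCoherentUnitFamilyOfCharacter`, `…InduceMomentsOfCharacter`,
`…DivisionAssemblyOfCharacter`); the semi-local units of the CM application live in RELATIVE Lubin–Tate towers over
the unramified bases `K(𝔣_m)_𝔓` (de Shalit I.1.8, II.4.5), whose Coleman theory is being typed separately.  THIS file
isolates the β-agnostic core: for ANY family `φ : B → 𝐃⟦X⟧` on a `G`-monoid `B` (abstract tower `(G, 𝒰, κ)` with the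
cell hypotheses `hU`/`hκ`/`hψ`) satisfying

  `hadd : φ (b * b') = φ b + φ b'`,
  `hgal : ∀ g ∈ U_0, ∀ b, ∃ a ∈ 𝒪[F], κ(g) = e(a) ∧ φ (g • b) = C(ι a) · (φ b ∘ [a]_{f'})`,

* §1 `comap_μ_seriesFamily_mul` / `_one` — **`D_{bb'} = D_b + D_{b'}`, `D_1 = 0`**;
* §2 ★★ `comap_μ_proj_mul_seriesFamily` — **the `U_0`-equivariance `hD`** (from the `𝐃`-level Lemma 3.4 (ii)
  `restrictUnits_density_unitInv_μ_unitMul_of_eq_C_mul_subst_homC'` through `comap_family_equivariant_of_character`);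
* §3 ★★ `induce_μ_mul/_one/_pow/_smul/_smul_inv/_of_transLE_eq_one_seriesFamily` — `i := induce D` is additive and a
  `G`-homomorphism (II.4.6 (14)), in both equivariance spellings.

Instantiations: absolute units `φ b = ((δ(η b))~).map ι` (hadd = `logDeriv_mul` + `tildeSer_add`, hgal =
`map_eq_C_mul_subst_homC'_of_eq` ∘ `tildeSer_logDeriv_galAct`); relative units over an unramified base likewise, once
their `(δ·)~` and Galois action are in the tree.  Everything is proved; no named facts, no definitions, no instances
(section-local instance attributes as in the siblings), no `sorry`.

## References

* [deShalit1987] E. de Shalit, *Iwasawa theory of elliptic curves with complex multiplication* (1987),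
  I.3.3 (7′)–(9) (p. 17–18), I.3.4 Lemma (i), (ii) and Corollary (p. 18), II.4.5–4.6 (12)–(14) (p. 58–59).
-/

noncomputable section

open MvPowerSeries Filter
open scoped Topology Classical

namespace Literature.NumberTheory.EllipticCurves

section SeriesFamilyOfCharacter

open ValuativeRel IsLocalRing Field GroupDistribution
open Literature.NumberTheory.GaloisRepresentations Literature.NumberTheory.GaloisRepresentations.IsNonarchimedeanLocalField
  Literature.NumberTheory.GaloisRepresentations.LubinTate Literature.NumberTheory.PAdicHodge

variable {F : Type} [Field F] [ValuativeRel F] [TopologicalSpace F] [IsNonarchimedeanLocalField F]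

attribute [local instance] ltNormUniformSpace ltNormIsUniformAddGroup rk1 nF nE fintypeResidueField

variable (hq : residueFieldCard F = 2) (h2 : (valuation F).IsUniformizer (((2 : ℕ) : 𝒪[F]) : F))
  {σ₀ : absoluteGaloisGroup F} (hσ₀ : IsAbsArithFrob σ₀) (u : 𝒪[F]ˣ)
  {ε : (maxUnramifiedCompletion F)ˣ}
  (hε : maxUnramifiedCompletion.galAut F σ₀ (ε : maxUnramifiedCompletion F) =
    algebraMap 𝒪[F] (maxUnramifiedCompletion F) (u : 𝒪[F]) * (ε : maxUnramifiedCompletion F))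
variable {𝕜 : Type*} [NormedField 𝕜] [NormedAlgebra ℚ_[2] 𝕜] [IsUltrametricDist 𝕜] [CompleteSpace 𝕜]
  (Θ : UnrCoeff F →+* 𝕜) (e : 𝒪[F] →+* ℤ_[2])
  (hΘe : ∀ a : 𝒪[F], Θ (intToUnrCoeff F a) = padicIntCast 𝕜 (e a))
variable {G : Type*} [Group G] {𝒰 : SubgroupTower G} [∀ n, (𝒰.U n).Normal] (κ : G →* ℤ_[2]ˣ)
  (hU : ∀ (n : ℕ) (g : G), g ∈ 𝒰.U n ↔ g ∈ 𝒰.U 0 ∧ PadicInt.toZModPow (n + 1) (κ g : ℤ_[2]) = 1)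
  (hκ : ∀ (n : ℕ) (w : ℤ_[2]ˣ), PadicInt.toZModPow 1 (w : ℤ_[2]) = 1 →
    ∃ g ∈ 𝒰.U 0, PadicInt.toZModPow (n + 1) (κ g : ℤ_[2]) = PadicInt.toZModPow (n + 1) (w : ℤ_[2]))
  (ψ : (n : ℕ) → G ⧸ 𝒰.U n → ZMod (2 ^ (n + 1)))
  (hψ : ∀ (n : ℕ) (g : G), g ∈ 𝒰.U 0 → ψ n (𝒰.proj n g) = PadicInt.toZModPow (n + 1) (κ g : ℤ_[2]))
variable {B : Type*} [CommMonoid B] [MulDistribMulAction G B] (φ : B → PowerSeries (UnrCoeff F))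
  (hadd : ∀ b b' : B, φ (b * b') = φ b + φ b')
  (hgal : ∀ g ∈ 𝒰.U 0, ∀ b : B, ∃ a : 𝒪[F], (κ g : ℤ_[2]) = e a ∧
    φ (g • b) = PowerSeries.C (intToUnrCoeff F a) * PowerSeries.subst (homC' h2 u a) (φ b))
  {C : ℝ} (hC : ∀ (b : B) (k : ℕ), ‖PowerSeries.coeff k ((PowerSeries.subst (compSeriesC h2 hσ₀ u hε) (φ b)).map Θ)‖ ≤ C)

/-! ### §1. Additivity -/

omit [NormedAlgebra ℚ_[2] 𝕜] [IsUltrametricDist 𝕜] [CompleteSpace 𝕜] in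
/-- `(φ_b + φ_{b'}) ∘ ϑ`, mapped, is the sum (substitution and `map` are additive). [cite: deShalit1987, I.3.4 Lemma (i) (p. 18)] -/
theorem map_subst_compSeriesC_add (φ₁ φ₂ : PowerSeries (UnrCoeff F)) :
    (PowerSeries.subst (compSeriesC h2 hσ₀ u hε) (φ₁ + φ₂)).map Θ =
      (PowerSeries.subst (compSeriesC h2 hσ₀ u hε) φ₁).map Θ + (PowerSeries.subst (compSeriesC h2 hσ₀ u hε) φ₂).map Θ := by
  rw [PowerSeries.subst_add (hasSubst_compSeriesC h2 hσ₀ u hε), map_add]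

omit [MulDistribMulAction G B] in
include hadd in
/-- **`D_{bb'} = D_b + D_{b'}` levelwise** for an additive series family. [cite: deShalit1987, I.3.4 Lemma (i) (p. 18), II.4.6 (p. 59)] -/
theorem comap_μ_seriesFamily_mul (b b' : B) (n : ℕ) (a : G ⧸ 𝒰.U n) :
    (GroupDistribution.comap (restrictUnits ((invAmice₁ 2 ((PowerSeries.subst (compSeriesC h2 hσ₀ u hε) (φ (b * b'))).map Θ) (hC (b * b'))).density
          (ProfiniteTower.padicInt_isUniform 2) (unitInv 𝕜) uniformContinuous_unitInv norm_unitInv_le))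
          ψ (𝒰.cellMap_trans κ ψ hψ) (𝒰.cellMap_injective κ hU ψ hψ) (𝒰.cellMap_fiberSurj κ hU hκ ψ hψ)).μ n a =
      (GroupDistribution.comap (restrictUnits ((invAmice₁ 2 ((PowerSeries.subst (compSeriesC h2 hσ₀ u hε) (φ b)).map Θ) (hC b)).density
          (ProfiniteTower.padicInt_isUniform 2) (unitInv 𝕜) uniformContinuous_unitInv norm_unitInv_le))
          ψ (𝒰.cellMap_trans κ ψ hψ) (𝒰.cellMap_injective κ hU ψ hψ) (𝒰.cellMap_fiberSurj κ hU hκ ψ hψ)).μ n a +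
        (GroupDistribution.comap (restrictUnits ((invAmice₁ 2 ((PowerSeries.subst (compSeriesC h2 hσ₀ u hε) (φ b')).map Θ) (hC b')).density
          (ProfiniteTower.padicInt_isUniform 2) (unitInv 𝕜) uniformContinuous_unitInv norm_unitInv_le))
          ψ (𝒰.cellMap_trans κ ψ hψ) (𝒰.cellMap_injective κ hU ψ hψ) (𝒰.cellMap_fiberSurj κ hU hκ ψ hψ)).μ n a := by
  have hP : ((PowerSeries.subst (compSeriesC h2 hσ₀ u hε) (φ (b * b'))).map Θ) =
      ((PowerSeries.subst (compSeriesC h2 hσ₀ u hε) (φ b)).map Θ) + ((PowerSeries.subst (compSeriesC h2 hσ₀ u hε) (φ b')).map Θ) := by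
    rw [hadd, map_subst_compSeriesC_add]
  have h₁ := invAmice₁_μ_eq_add_of_eq_add (p := 2) hP (hC (b * b')) (hC b) (hC b')
  have h₂ := BoundedDistribution.density_μ_eq_add_of_μ_eq_add _ _ _ h₁ (ProfiniteTower.padicInt_isUniform 2)
    (unitInv 𝕜) uniformContinuous_unitInv norm_unitInv_le
  have h₃ := restrictUnits_μ_eq_add_of_μ_eq_add _ _ _ h₂
  exact GroupDistribution.comap_μ_eq_add_of_μ_eq_add (T := (ProfiniteTower.padicInt 2).succ) _ _ _ ψ _ _ _ h₃ n a

omit [MulDistribMulAction G B] in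
include hadd in
/-- **`D_1 = 0` levelwise** (`φ_1 = φ_1 + φ_1`). [cite: deShalit1987, I.3.4 Lemma (i) (p. 18)] -/
theorem comap_μ_seriesFamily_one (n : ℕ) (a : G ⧸ 𝒰.U n) :
    (GroupDistribution.comap (restrictUnits ((invAmice₁ 2 ((PowerSeries.subst (compSeriesC h2 hσ₀ u hε) (φ 1)).map Θ) (hC 1)).density
          (ProfiniteTower.padicInt_isUniform 2) (unitInv 𝕜) uniformContinuous_unitInv norm_unitInv_le))
          ψ (𝒰.cellMap_trans κ ψ hψ) (𝒰.cellMap_injective κ hU ψ hψ) (𝒰.cellMap_fiberSurj κ hU hκ ψ hψ)).μ n a = 0 := by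
  have h := comap_μ_seriesFamily_mul h2 hσ₀ u hε Θ κ hU hκ ψ hψ φ hadd hC 1 1 n a
  rw [show (1 : B) * 1 = 1 from mul_one 1] at h
  exact left_eq_add.mp h

/-! ### §2. The `U_0`-equivariance `hD` -/

include hq hΘe hgal in
/-- ★★ **`U_0`-equivariance of `b ↦ D_b`**: for `g ∈ U_0`, `b ∈ B` and every cell `a ⊆ U_0`, **`D_{g•b}(ḡ a) = D_b(a)`**
(the hypothesis `hD` of `GroupDistribution.induce`), from `φ_{g•b} = κ(g)·(φ_b ∘ [κ(g)]_{f'})`.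
[cite: deShalit1987, I.3.4 Lemma (ii) (p. 18), II.4.6 (14) (p. 59)] -/
theorem comap_μ_proj_mul_seriesFamily :
    ∀ g ∈ 𝒰.U 0, ∀ (b : B) (n : ℕ) (a : G ⧸ 𝒰.U n), 𝒰.transLE (Nat.zero_le n) a = 1 →
      (GroupDistribution.comap (restrictUnits ((invAmice₁ 2 ((PowerSeries.subst (compSeriesC h2 hσ₀ u hε) (φ (g • b))).map Θ) (hC (g • b))).density
          (ProfiniteTower.padicInt_isUniform 2) (unitInv 𝕜) uniformContinuous_unitInv norm_unitInv_le))
          ψ (𝒰.cellMap_trans κ ψ hψ) (𝒰.cellMap_injective κ hU ψ hψ) (𝒰.cellMap_fiberSurj κ hU hκ ψ hψ)).μ n (𝒰.proj n g * a) =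
        (GroupDistribution.comap (restrictUnits ((invAmice₁ 2 ((PowerSeries.subst (compSeriesC h2 hσ₀ u hε) (φ b)).map Θ) (hC b)).density
          (ProfiniteTower.padicInt_isUniform 2) (unitInv 𝕜) uniformContinuous_unitInv norm_unitInv_le))
          ψ (𝒰.cellMap_trans κ ψ hψ) (𝒰.cellMap_injective κ hU ψ hψ) (𝒰.cellMap_fiberSurj κ hU hκ ψ hψ)).μ n a := by
  refine GroupDistribution.comap_family_equivariant_of_character κ
    (fun b ↦ (restrictUnits ((invAmice₁ 2 ((PowerSeries.subst (compSeriesC h2 hσ₀ u hε) (φ b)).map Θ) (hC b)).density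
          (ProfiniteTower.padicInt_isUniform 2) (unitInv 𝕜) uniformContinuous_unitInv norm_unitInv_le))) hU hκ ψ hψ ?_
  intro g hg b n c
  obtain ⟨a, ha, hφ⟩ := hgal g hg b
  exact restrictUnits_density_unitInv_μ_unitMul_of_eq_C_mul_subst_homC' hq h2 hσ₀ u hε Θ e hΘe a (κ g) ha
    (φ b) (φ (g • b)) hφ (hC b) (hC (g • b)) n c

/-! ### §3. `i := induce D` -/

variable (hC0 : 0 ≤ C) (hCb : ∀ b : B, (GroupDistribution.comap (restrictUnits ((invAmice₁ 2 ((PowerSeries.subst (compSeriesC h2 hσ₀ u hε) (φ b)).map Θ) (hC b)).density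
          (ProfiniteTower.padicInt_isUniform 2) (unitInv 𝕜) uniformContinuous_unitInv norm_unitInv_le))
          ψ (𝒰.cellMap_trans κ ψ hψ) (𝒰.cellMap_injective κ hU ψ hψ) (𝒰.cellMap_fiberSurj κ hU hκ ψ hψ)).bound ≤ C)

include hadd in
/-- ★★ **`i(bb')_n(a) = i(b)_n(a) + i(b')_n(a)`** (the `hi_mul` of the division step).
[cite: deShalit1987, I.3.4 Lemma (i) and Corollary (p. 18), II.4.6 (p. 59)] -/
theorem induce_μ_mul_seriesFamily (b b' : B) (n : ℕ) (a : G ⧸ 𝒰.U n) :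
    (GroupDistribution.induce (fun b ↦ (GroupDistribution.comap (restrictUnits ((invAmice₁ 2 ((PowerSeries.subst (compSeriesC h2 hσ₀ u hε) (φ b)).map Θ) (hC b)).density
          (ProfiniteTower.padicInt_isUniform 2) (unitInv 𝕜) uniformContinuous_unitInv norm_unitInv_le))
          ψ (𝒰.cellMap_trans κ ψ hψ) (𝒰.cellMap_injective κ hU ψ hψ) (𝒰.cellMap_fiberSurj κ hU hκ ψ hψ))) hC0 hCb (b * b')).μ n a =
      (GroupDistribution.induce (fun b ↦ (GroupDistribution.comap (restrictUnits ((invAmice₁ 2 ((PowerSeries.subst (compSeriesC h2 hσ₀ u hε) (φ b)).map Θ) (hC b)).density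
          (ProfiniteTower.padicInt_isUniform 2) (unitInv 𝕜) uniformContinuous_unitInv norm_unitInv_le))
          ψ (𝒰.cellMap_trans κ ψ hψ) (𝒰.cellMap_injective κ hU ψ hψ) (𝒰.cellMap_fiberSurj κ hU hκ ψ hψ))) hC0 hCb b).μ n a +
        (GroupDistribution.induce (fun b ↦ (GroupDistribution.comap (restrictUnits ((invAmice₁ 2 ((PowerSeries.subst (compSeriesC h2 hσ₀ u hε) (φ b)).map Θ) (hC b)).density
          (ProfiniteTower.padicInt_isUniform 2) (unitInv 𝕜) uniformContinuous_unitInv norm_unitInv_le))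
          ψ (𝒰.cellMap_trans κ ψ hψ) (𝒰.cellMap_injective κ hU ψ hψ) (𝒰.cellMap_fiberSurj κ hU hκ ψ hψ))) hC0 hCb b').μ n a :=
  GroupDistribution.induce_μ_mul _ hC0 hCb
    (fun b b' n a ↦ comap_μ_seriesFamily_mul h2 hσ₀ u hε Θ κ hU hκ ψ hψ φ hadd hC b b' n a) b b' n a

include hadd in
/-- **`i(1) = 0`.** [cite: deShalit1987, I.3.4 Lemma (i) (p. 18)] -/
theorem induce_μ_one_seriesFamily (n : ℕ) (a : G ⧸ 𝒰.U n) :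
    (GroupDistribution.induce (fun b ↦ (GroupDistribution.comap (restrictUnits ((invAmice₁ 2 ((PowerSeries.subst (compSeriesC h2 hσ₀ u hε) (φ b)).map Θ) (hC b)).density
          (ProfiniteTower.padicInt_isUniform 2) (unitInv 𝕜) uniformContinuous_unitInv norm_unitInv_le))
          ψ (𝒰.cellMap_trans κ ψ hψ) (𝒰.cellMap_injective κ hU ψ hψ) (𝒰.cellMap_fiberSurj κ hU hκ ψ hψ))) hC0 hCb 1).μ n a = 0 := by
  have h := induce_μ_mul_seriesFamily h2 hσ₀ u hε Θ κ hU hκ ψ hψ φ hadd hC hC0 hCb 1 1 n a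
  rw [show (1 : B) * 1 = 1 from mul_one 1] at h
  exact left_eq_add.mp h

include hadd in
/-- **`i(b^N) = N · i(b)`.** [cite: deShalit1987, I.3.4 Lemma (i) (p. 18), II.4.12 (p. 69)] -/
theorem induce_μ_pow_seriesFamily (b : B) (N n : ℕ) (a : G ⧸ 𝒰.U n) :
    (GroupDistribution.induce (fun b ↦ (GroupDistribution.comap (restrictUnits ((invAmice₁ 2 ((PowerSeries.subst (compSeriesC h2 hσ₀ u hε) (φ b)).map Θ) (hC b)).density
          (ProfiniteTower.padicInt_isUniform 2) (unitInv 𝕜) uniformContinuous_unitInv norm_unitInv_le))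
          ψ (𝒰.cellMap_trans κ ψ hψ) (𝒰.cellMap_injective κ hU ψ hψ) (𝒰.cellMap_fiberSurj κ hU hκ ψ hψ))) hC0 hCb (b ^ N)).μ n a =
      (N : 𝕜) * (GroupDistribution.induce (fun b ↦ (GroupDistribution.comap (restrictUnits ((invAmice₁ 2 ((PowerSeries.subst (compSeriesC h2 hσ₀ u hε) (φ b)).map Θ) (hC b)).density
          (ProfiniteTower.padicInt_isUniform 2) (unitInv 𝕜) uniformContinuous_unitInv norm_unitInv_le))
          ψ (𝒰.cellMap_trans κ ψ hψ) (𝒰.cellMap_injective κ hU ψ hψ) (𝒰.cellMap_fiberSurj κ hU hκ ψ hψ))) hC0 hCb b).μ n a := by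
  induction N with
  | zero => rw [pow_zero b, induce_μ_one_seriesFamily h2 hσ₀ u hε Θ κ hU hκ ψ hψ φ hadd hC hC0 hCb, Nat.cast_zero,
      zero_mul]
  | succ N ih => rw [pow_succ b N, induce_μ_mul_seriesFamily h2 hσ₀ u hε Θ κ hU hκ ψ hψ φ hadd hC hC0 hCb, ih,
      Nat.cast_add_one N]; ring

include hq hΘe hgal in
/-- ★★ **`i(g • b)_n(ḡ a) = i(b)_n(a)` for EVERY `g ∈ G`** (II.4.6: "`i` is a `𝒢`-homomorphism").
[cite: deShalit1987, I.3.4 Lemma (ii) and Corollary (p. 18), II.4.6 (14) (p. 59)] -/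
theorem induce_μ_smul_seriesFamily (g : G) (b : B) (n : ℕ) (a : G ⧸ 𝒰.U n) :
    (GroupDistribution.induce (fun b ↦ (GroupDistribution.comap (restrictUnits ((invAmice₁ 2 ((PowerSeries.subst (compSeriesC h2 hσ₀ u hε) (φ b)).map Θ) (hC b)).density
          (ProfiniteTower.padicInt_isUniform 2) (unitInv 𝕜) uniformContinuous_unitInv norm_unitInv_le))
          ψ (𝒰.cellMap_trans κ ψ hψ) (𝒰.cellMap_injective κ hU ψ hψ) (𝒰.cellMap_fiberSurj κ hU hκ ψ hψ))) hC0 hCb (g • b)).μ n (𝒰.proj n g * a) =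
      (GroupDistribution.induce (fun b ↦ (GroupDistribution.comap (restrictUnits ((invAmice₁ 2 ((PowerSeries.subst (compSeriesC h2 hσ₀ u hε) (φ b)).map Θ) (hC b)).density
          (ProfiniteTower.padicInt_isUniform 2) (unitInv 𝕜) uniformContinuous_unitInv norm_unitInv_le))
          ψ (𝒰.cellMap_trans κ ψ hψ) (𝒰.cellMap_injective κ hU ψ hψ) (𝒰.cellMap_fiberSurj κ hU hκ ψ hψ))) hC0 hCb b).μ n a :=
  GroupDistribution.induce_μ_smul _ hC0 hCb
    (comap_μ_proj_mul_seriesFamily hq h2 hσ₀ u hε Θ e hΘe κ hU hκ ψ hψ φ hgal hC) g b n a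

include hq hΘe hgal in
/-- The same in the spelling `i(g • b)_n(a) = i(b)_n(ḡ⁻¹ a)` (the `hi_smul` of the division step).
[cite: deShalit1987, II.4.6 (14) (p. 59)] -/
theorem induce_μ_smul_inv_seriesFamily (g : G) (b : B) (n : ℕ) (a : G ⧸ 𝒰.U n) :
    (GroupDistribution.induce (fun b ↦ (GroupDistribution.comap (restrictUnits ((invAmice₁ 2 ((PowerSeries.subst (compSeriesC h2 hσ₀ u hε) (φ b)).map Θ) (hC b)).density
          (ProfiniteTower.padicInt_isUniform 2) (unitInv 𝕜) uniformContinuous_unitInv norm_unitInv_le))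
          ψ (𝒰.cellMap_trans κ ψ hψ) (𝒰.cellMap_injective κ hU ψ hψ) (𝒰.cellMap_fiberSurj κ hU hκ ψ hψ))) hC0 hCb (g • b)).μ n a =
      (GroupDistribution.induce (fun b ↦ (GroupDistribution.comap (restrictUnits ((invAmice₁ 2 ((PowerSeries.subst (compSeriesC h2 hσ₀ u hε) (φ b)).map Θ) (hC b)).density
          (ProfiniteTower.padicInt_isUniform 2) (unitInv 𝕜) uniformContinuous_unitInv norm_unitInv_le))
          ψ (𝒰.cellMap_trans κ ψ hψ) (𝒰.cellMap_injective κ hU ψ hψ) (𝒰.cellMap_fiberSurj κ hU hκ ψ hψ))) hC0 hCb b).μ n ((𝒰.proj n g)⁻¹ * a) := by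
  have h := induce_μ_smul_seriesFamily hq h2 hσ₀ u hε Θ e hΘe κ hU hκ ψ hψ φ hgal hC hC0 hCb g b n ((𝒰.proj n g)⁻¹ * a)
  rwa [mul_inv_cancel_left] at h

include hq hΘe hgal in
/-- **`i(b)` reads `D_b` on the cells inside `U_0`.** [cite: deShalit1987, I.3.4 (p. 18), II.4.6 (13) (p. 59)] -/
theorem induce_μ_of_transLE_eq_one_seriesFamily (b : B) (n : ℕ) (a : G ⧸ 𝒰.U n)
    (ha : 𝒰.transLE (Nat.zero_le n) a = 1) :
    (GroupDistribution.induce (fun b ↦ (GroupDistribution.comap (restrictUnits ((invAmice₁ 2 ((PowerSeries.subst (compSeriesC h2 hσ₀ u hε) (φ b)).map Θ) (hC b)).density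
          (ProfiniteTower.padicInt_isUniform 2) (unitInv 𝕜) uniformContinuous_unitInv norm_unitInv_le))
          ψ (𝒰.cellMap_trans κ ψ hψ) (𝒰.cellMap_injective κ hU ψ hψ) (𝒰.cellMap_fiberSurj κ hU hκ ψ hψ))) hC0 hCb b).μ n a = (GroupDistribution.comap (restrictUnits ((invAmice₁ 2 ((PowerSeries.subst (compSeriesC h2 hσ₀ u hε) (φ b)).map Θ) (hC b)).density
          (ProfiniteTower.padicInt_isUniform 2) (unitInv 𝕜) uniformContinuous_unitInv norm_unitInv_le))
          ψ (𝒰.cellMap_trans κ ψ hψ) (𝒰.cellMap_injective κ hU ψ hψ) (𝒰.cellMap_fiberSurj κ hU hκ ψ hψ)).μ n a :=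
  GroupDistribution.induce_μ_of_transLE_eq_one _ hC0 hCb
    (comap_μ_proj_mul_seriesFamily hq h2 hσ₀ u hε Θ e hΘe κ hU hκ ψ hψ φ hgal hC) b n a ha

end SeriesFamilyOfCharacter

end Literature.NumberTheory.EllipticCurves

end
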